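import Summits.ValiantsHypothesis.ValiantsHypothesis.Theorems.BinomialElusivePeelingLemmaGadgetBlockSides
import Summits.ValiantsHypothesis.ValiantsHypothesis.Theorems.BinomialElusivePeelingLemmaGadgetBlockMinus
import Summits.ValiantsHypothesis.ValiantsHypothesis.Theorems.BinomialElusivePeelingLemmaPeriodicity

/-!
# The block theta gadget, IX: `S⁻ = S¹ - S²` read on private letters and on `b`-letters (§3h (R1))

Helper for the crux stmt-ValiantsHypothesis-7391 (negative lane; `Cruxes/PeelingLemma/DETERMINISTIC-ALLX.md`
§3h (R1), the translation layer between the window-level sides `S¹`, `S²` of a gadget-restricted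
relation and the arithmetic rigidity lemmas `gadget_rigid` / `top_rigid`).  With `L = no + 2q + 2`
edges per arm and `d = u - v`:
* `sminus_eq_vsum`: at any letter that is not a `b'`-letter, `S¹ - S²` is the vertex-charge
  combination with charges `d j 0` at `b` and `d j t - d j (t-1)` at vertex `t ≥ 1` (the `b'`
  boundary terms of `arm_sides_sub_eq` vanish there, `win3_b'_eq_zero`);
* `sminus_apply_private`: the private letter born at vertex `t₀` of arm `j` (`1 ≤ t₀`, `t₀ + 2q ≤ no + 1`)
  reads `Σ_{t ∈ [t₀, t₀+2q]} (-1)^{t-t₀} (d j t - d j (t-1))` — the `hread` shape of `gadget_rigid`;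
* `sminus_apply_beta`: `beta a` reads `(-1)^a · (Σ_j d j 0 + Σ_j Σ_{t ∈ [1, 2q - blockAge j a]} (-1)^t (d j t - d j (t-1)))`
  — the `hbeta` shape.  No Theses import.
-/

namespace Summit.ValiantsHypothesis.ValiantsHypothesis.Theorems.PeelingLemmaGadget

-- summit = sub-problem name (single-conjunct summit, D-0017 layout), so the namespace repeats it
set_option linter.dupNamespace false

open scoped BigOperators
open Finset
open Summit.ValiantsHypothesis.ValiantsHypothesis.Theorems.PeelingLemmaWindow
open Summit.ValiantsHypothesis.ValiantsHypothesis.Theorems.PeelingLemmaRigidity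

variable {q R no : ℕ}

/-- **`S⁻` as a vertex-charge combination** away from the `b'`-letters. -/
theorem sminus_eq_vsum (u v : Fin 5 → ℕ → ℤ) (ν : GLetter q no) (hν : ∀ a, ν ≠ GLetter.beta' a) :
    (∑ j, ∑ t ∈ Finset.range (no + 2 * q + 2),
        (u j t * win (birth3 q R no j) q ((2 * q + t : ℕ) : ℤ) ν +
          v j t * win (birth3 q R no j) q ((2 * q + t + 1 : ℕ) : ℤ) ν)) -
      ∑ j, ∑ t ∈ Finset.range (no + 2 * q + 2),
        (v j t * win (birth3 q R no j) q ((2 * q + t : ℕ) : ℤ) ν +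
          u j t * win (birth3 q R no j) q ((2 * q + t + 1 : ℕ) : ℤ) ν) =
      ∑ j, ∑ t ∈ Finset.range (no + 2 * q + 2),
        ((u j t - v j t) - (if t = 0 then 0 else (u j (t - 1) - v j (t - 1)))) *
          win (birth3 q R no j) q ((2 * q + t : ℕ) : ℤ) ν := by
  rw [← Finset.sum_sub_distrib]
  refine Finset.sum_congr rfl fun j _ => ?_
  rw [arm_sides_sub_eq (birth3 q R no j) (u j) (v j) (no + 2 * q + 2) ν, if_neg (by omega)]
  have hb' : win (birth3 q R no j) q ((2 * q + (no + 2 * q + 2) : ℕ) : ℤ) ν = 0 := by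
    rw [show 2 * q + (no + 2 * q + 2) = 4 * q + no + 2 by ring]
    exact win3_b'_eq_zero j ν hν
  rw [hb', mul_zero, sub_zero]

/-- **Private reading of `S⁻`.**  For `1 ≤ t₀` and `t₀ + 2q ≤ no + 1` (so the whole life of the letter
consists of gadget vertices and the letter is private), the letter born at vertex `t₀` of arm `j`
reads `Σ_{t ∈ [t₀, t₀+2q]} (-1)^{t-t₀} (d j t - d j (t-1))` in `S¹ - S²`. -/
theorem sminus_apply_private (u v : Fin 5 → ℕ → ℤ) (j : Fin 5) {t₀ : ℕ} (h1 : 1 ≤ t₀)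
    (h2 : t₀ + 2 * q ≤ no + 1) :
    (∑ j', ∑ t ∈ Finset.range (no + 2 * q + 2),
        (u j' t * win (birth3 q R no j') q ((2 * q + t : ℕ) : ℤ) (birth3 q R no j ((2 * q + t₀ : ℕ) : ℤ)) +
          v j' t * win (birth3 q R no j') q ((2 * q + t + 1 : ℕ) : ℤ) (birth3 q R no j ((2 * q + t₀ : ℕ) : ℤ)))) -
      ∑ j', ∑ t ∈ Finset.range (no + 2 * q + 2),
        (v j' t * win (birth3 q R no j') q ((2 * q + t : ℕ) : ℤ) (birth3 q R no j ((2 * q + t₀ : ℕ) : ℤ)) +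
          u j' t * win (birth3 q R no j') q ((2 * q + t + 1 : ℕ) : ℤ) (birth3 q R no j ((2 * q + t₀ : ℕ) : ℤ))) =
      ∑ t ∈ Finset.Icc t₀ (t₀ + 2 * q), (-1) ^ (t - t₀) * ((u j t - v j t) - (u j (t - 1) - v j (t - 1))) := by
  have hpriv : ∀ a, birth3 q R no j ((2 * q + t₀ : ℕ) : ℤ) ≠ GLetter.beta' a := by
    intro a h
    have := (birth3_eq_beta'_iff j _ a).mp h
    have hlt := (blockAge q R j a).isLt
    push_cast at this; omega
  rw [sminus_eq_vsum u v _ hpriv,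
    vsum_apply_private (fun j t => (u j t - v j t) - (if t = 0 then 0 else (u j (t - 1) - v j (t - 1))))
      (no + 2 * q + 2) j h1 (by omega),
    filter_window_eq_Icc (by omega)]
  refine Finset.sum_congr rfl fun t ht => ?_
  have := (Finset.mem_Icc.mp ht).1
  simp only [if_neg (show t ≠ 0 by omega)]

/-- **Reading of a `b`-letter in `S⁻`.**  `beta a` reads
`(-1)^a · (Σ_j (u-v) j 0 + Σ_j Σ_{t ∈ [1, 2q - blockAge j a]} (-1)^t ((u-v) j t - (u-v) j (t-1)))`. -/
theorem sminus_apply_beta (u v : Fin 5 → ℕ → ℤ) (a : Fin (2 * q + 1)) :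
    (∑ j, ∑ t ∈ Finset.range (no + 2 * q + 2),
        (u j t * win (birth3 q R no j) q ((2 * q + t : ℕ) : ℤ) (GLetter.beta a) +
          v j t * win (birth3 q R no j) q ((2 * q + t + 1 : ℕ) : ℤ) (GLetter.beta a))) -
      ∑ j, ∑ t ∈ Finset.range (no + 2 * q + 2),
        (v j t * win (birth3 q R no j) q ((2 * q + t : ℕ) : ℤ) (GLetter.beta a) +
          u j t * win (birth3 q R no j) q ((2 * q + t + 1 : ℕ) : ℤ) (GLetter.beta a)) =
      (-1) ^ (a : ℕ) * ((∑ j, (u j 0 - v j 0)) +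
        ∑ j, ∑ t ∈ Finset.Icc 1 (2 * q - ((blockAge q R j a : Fin (2 * q + 1)) : ℕ)),
          (-1) ^ t * ((u j t - v j t) - (u j (t - 1) - v j (t - 1)))) := by
  rw [sminus_eq_vsum u v _ (fun a' h => by cases h),
    vsum_apply_beta (fun j t => (u j t - v j t) - (if t = 0 then 0 else (u j (t - 1) - v j (t - 1))))
      (no + 2 * q + 2) a,
    mul_add, Finset.mul_sum, Finset.mul_sum, ← Finset.sum_add_distrib]
  refine Finset.sum_congr rfl fun j _ => ?_
  have hlt := (blockAge q R j a).isLt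
  set fa := ((blockAge q R j a : Fin (2 * q + 1)) : ℕ) with hfa
  have hpar : ((-1 : ℤ) ^ fa) = (-1) ^ (a : ℕ) := neg_one_pow_of_mod_two_eq (blockAge_parity q R j a)
  -- the filter `t ≤ 2q - fa` inside `range (no+2q+2)` is `{0} ∪ Icc 1 (2q - fa)`
  have hf : (Finset.range (no + 2 * q + 2)).filter (fun t => t ≤ 2 * q - fa) = Finset.range (2 * q - fa + 1) := by
    ext t; simp only [Finset.mem_filter, Finset.mem_range]; omega
  rw [hf, Finset.sum_range_succ', show Finset.Icc 1 (2 * q - fa) = Finset.Ico 1 (2 * q - fa + 1) from rfl,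
    Finset.sum_Ico_eq_sum_range, Nat.add_sub_cancel]
  have h0 : ((-1 : ℤ) ^ (0 + fa)) * ((u j 0 - v j 0) - (if (0 : ℕ) = 0 then 0 else (u j (0 - 1) - v j (0 - 1)))) =
      (-1) ^ (a : ℕ) * (u j 0 - v j 0) := by
    rw [if_pos rfl, sub_zero, zero_add, hpar]
  have hk : ∀ k ∈ Finset.range (2 * q - fa),
      ((-1 : ℤ) ^ (k + 1 + fa)) * ((u j (k + 1) - v j (k + 1)) -
        (if k + 1 = 0 then 0 else (u j (k + 1 - 1) - v j (k + 1 - 1)))) =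
      (-1) ^ (a : ℕ) * ((-1) ^ (1 + k) * ((u j (1 + k) - v j (1 + k)) - (u j (1 + k - 1) - v j (1 + k - 1)))) := by
    intro k _
    rw [if_neg (by omega), Nat.add_sub_cancel, show 1 + k = k + 1 by ring, Nat.add_sub_cancel]
    simp only [pow_add, pow_one]
    rw [hpar]; ring
  rw [Finset.sum_congr rfl hk, h0, ← Finset.mul_sum]
  ring

end Summit.ValiantsHypothesis.ValiantsHypothesis.Theorems.PeelingLemmaGadget
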